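import Summits.Ventures.HodgeRepro2.T5SU11ResolventL1Bound

/-!
# Summary XV — the resolvent of the radial Laplacian for `λ > 2`: the constant source, the `L^∞` theory on bounded
continuous sources and the `L¹` bound (rows 542–544), under uniform names

For `λ > 2` (`μ = λ(λ − 2) > 0`):

* `resolvent_const` — **`G^I_λ 1 ≡ −1/μ` on `(0, ∞)`** (row 542);
* `linfty_bound` — **`|G^I_λ g(t)| ≤ ‖g‖_∞/μ` for every bounded continuous source** — the sharp `L^∞` bound (row 542);
* `resolvent_continuous` — `G^I_λ g` is continuous on `(0, ∞)` for a bounded continuous source (row 543);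
* `linfty_lipschitz` — `‖G^I_λ g − G^I_{λ₂} g‖_∞ ≤ |μ − μ₂| ‖g‖_∞/(μ μ₂)` (row 543);
* `linfty_iterates` — `(G^I_λ)ⁿ g` is continuous with `‖(G^I_λ)ⁿ g‖_∞ ≤ ‖g‖_∞/μⁿ` (row 543);
* `neumann_remainder_sup`, `neumann_sup` — **the Neumann series `Σ (μ − μ₂)^k (G^I_{λ₂})^{k+1} g` converges to `G^I_λ g`
  uniformly on `(0, ∞)` for `|μ − μ₂| < μ₂`**, with the remainder `≤ (|μ − μ₂|/μ₂)^{n+1} ‖g‖_∞/μ` (row 543);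
* `kernel_row_sum` — **`∫_{(0,∞)} |K_λ(t, s)| sinh 2s ds = 1/μ` for every `t > 0`** — Schur's bound (row 543);
* `l1_bound` — **`∫ |G^I_λ g| sinh 2t ≤ (∫ |g| sinh 2s)/μ` for a source of the class at a rate `ε > 2`** (row 544).

Nothing is claimed about (N).

Blind lane: Mathlib + the HodgeRepro2 prefix only; no sorry; axioms ⊆ {propext, Classical.choice,
Quot.sound}.
-/

namespace Summit.Ventures.HodgeRepro2.T5SU11RadialSummaryXV

open Filter Topology MeasureTheory
open Set (Ioi Ioc)
open T5SU11Cartan T5SU11SphericalFunction T5SU11SphericalDecay T5SU11RadialGreenImproper T5SU11RadialGreenKernel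
  T5SU11ResolventConstantSource T5SU11ResolventSupNorm T5SU11ResolventL1Bound

section measure

variable [MeasurableSpace Circle] [BorelSpace Circle]

variable {lam : ℝ} (h2 : 2 < lam) {g : ℝ → ℝ} (hg : ContinuousOn g (Ioi 0)) {K : ℝ} (hK : ∀ s, 0 < s → |g s| ≤ K)

include h2 in
/-- **The resolvent of the constant source**: `G^I_λ 1 ≡ −1/μ` on `(0, ∞)` for `λ > 2` (row 542). -/
theorem resolvent_const {t : ℝ} (ht : 0 < t) :
    greenSolI (fun t => sph lam (hyp t)) (sphDecay lam) (fun _ => (1 : ℝ)) t = -1 / (lam * (lam - 2)) :=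
  greenSolI_one_eq (by linarith) h2 ht

include h2 hg hK in
/-- **The sharp `L^∞` bound of the resolvent**: `|G^I_λ g(t)| ≤ ‖g‖_∞/μ` for every `t > 0` and every bounded
continuous source `g`, `λ > 2` (row 542). -/
theorem linfty_bound {t : ℝ} (ht : 0 < t) :
    |greenSolI (fun t => sph lam (hyp t)) (sphDecay lam) g t| ≤ K / (lam * (lam - 2)) :=
  abs_greenSolI_le_div (by linarith) h2 hg hK ht

include h2 hg hK in
/-- `G^I_λ g` is continuous on `(0, ∞)` for a bounded continuous source, `λ > 2` (row 543). -/
theorem resolvent_continuous :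
    ContinuousOn (greenSolI (fun t => sph lam (hyp t)) (sphDecay lam) g) (Ioi 0) :=
  continuousOn_greenSolI_of_bounded h2 hg hK

include h2 hg hK in
/-- **The resolvent is Lipschitz in `μ` in the sup-norm**: `|G^I_λ g(t) − G^I_{λ₂} g(t)| ≤ |μ − μ₂| ‖g‖_∞/(μ μ₂)`
for `λ, λ₂ > 2` (row 543). -/
theorem linfty_lipschitz {lam₂ : ℝ} (h2' : 2 < lam₂) {t : ℝ} (ht : 0 < t) :
    |greenSolI (fun t => sph lam (hyp t)) (sphDecay lam) g t - greenSolI (fun t => sph lam₂ (hyp t)) (sphDecay lam₂) g t|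
      ≤ |lam * (lam - 2) - lam₂ * (lam₂ - 2)| * K / (lam * (lam - 2) * (lam₂ * (lam₂ - 2))) :=
  abs_greenSolI_sub_le_div h2 hg hK h2' ht

include h2 hg hK in
/-- **The iterates in the sup-norm**: `(G^I_λ)ⁿ g` is continuous on `(0, ∞)` with `‖(G^I_λ)ⁿ g‖_∞ ≤ ‖g‖_∞/μⁿ`
(row 543). -/
theorem linfty_iterates (n : ℕ) :
    ContinuousOn ((greenSolI (fun t => sph lam (hyp t)) (sphDecay lam))^[n] g) (Ioi 0) ∧
      ∀ s, 0 < s → |((greenSolI (fun t => sph lam (hyp t)) (sphDecay lam))^[n] g) s| ≤ K / (lam * (lam - 2)) ^ n :=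
  abs_iterate_le_div h2 hg hK n

include h2 hg hK in
/-- **The remainder of the Neumann series in the sup-norm**:
`|G^I_λ g(t) − Σ_{k ≤ n} (μ − μ₂)^k (G^I_{λ₂})^{k+1} g(t)| ≤ (|μ − μ₂|/μ₂)^{n+1} ‖g‖_∞/μ` (row 543). -/
theorem neumann_remainder_sup {lam₂ : ℝ} (h2' : 2 < lam₂) (n : ℕ) {t : ℝ} (ht : 0 < t) :
    |greenSolI (fun t => sph lam (hyp t)) (sphDecay lam) g t
        - ∑ k ∈ Finset.range (n + 1), (lam * (lam - 2) - lam₂ * (lam₂ - 2)) ^ k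
          * (greenSolI (fun t => sph lam₂ (hyp t)) (sphDecay lam₂))^[k + 1] g t|
      ≤ (|lam * (lam - 2) - lam₂ * (lam₂ - 2)| / (lam₂ * (lam₂ - 2))) ^ (n + 1) * (K / (lam * (lam - 2))) :=
  abs_neumann_remainder_le h2 hg hK h2' n ht

include h2 hg hK in
/-- **The Neumann series converges uniformly on `(0, ∞)` for `|μ − μ₂| < μ₂`** (`λ, λ₂ > 2`; row 543). -/
theorem neumann_sup {lam₂ : ℝ} (h2' : 2 < lam₂)
    (hq : |lam * (lam - 2) - lam₂ * (lam₂ - 2)| < lam₂ * (lam₂ - 2)) :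
    Tendsto (fun n : ℕ => (|lam * (lam - 2) - lam₂ * (lam₂ - 2)| / (lam₂ * (lam₂ - 2))) ^ (n + 1)
      * (K / (lam * (lam - 2)))) atTop (𝓝 0) ∧
    ∀ n : ℕ, ∀ t, 0 < t → |greenSolI (fun t => sph lam (hyp t)) (sphDecay lam) g t
        - ∑ k ∈ Finset.range (n + 1), (lam * (lam - 2) - lam₂ * (lam₂ - 2)) ^ k
          * (greenSolI (fun t => sph lam₂ (hyp t)) (sphDecay lam₂))^[k + 1] g t|
      ≤ (|lam * (lam - 2) - lam₂ * (lam₂ - 2)| / (lam₂ * (lam₂ - 2))) ^ (n + 1) * (K / (lam * (lam - 2))) :=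
  tendsto_neumann_sup h2 hg hK h2' hq

include h2 in
/-- **The row sums of the kernel**: `∫_{(0,∞)} |K_λ(t, s)| sinh 2s ds = 1/μ` for every `t > 0`, `λ > 2` (row 543). -/
theorem kernel_row_sum {t : ℝ} (ht : 0 < t) :
    ∫ s in Ioi 0, |sphGreenKernel lam t s| * Real.sinh (2 * s) = 1 / (lam * (lam - 2)) :=
  integral_abs_sphGreenKernel_mul_sinh h2 ht

include h2 hg in
/-- **The `L¹` bound of the resolvent**: `∫ |G^I_λ g| sinh 2t ≤ (∫ |g| sinh 2s)/μ` for `λ > 2` and a source of the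
class at a rate `ε > 2` (row 544). -/
theorem l1_bound {M : ℝ} (hM : ∀ s ∈ Ioc (0 : ℝ) 1, |g s| ≤ M) (hM0 : 0 ≤ M)
    {ε C s₀ : ℝ} (hε : 2 < ε) (hC : ∀ s, s₀ ≤ s → |g s| ≤ C * Real.exp (-ε * s)) :
    ∫ t in Ioi 0, |greenSolI (fun t => sph lam (hyp t)) (sphDecay lam) g t| * Real.sinh (2 * t)
      ≤ (∫ s in Ioi 0, |g s| * Real.sinh (2 * s)) / (lam * (lam - 2)) :=
  integral_abs_greenSolI_mul_sinh_le h2 hg hM hM0 hε hC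

end measure

end Summit.Ventures.HodgeRepro2.T5SU11RadialSummaryXV
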